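import Literature.Barriers.AtomisticToContinuum.NoBVEstimatesMultiDEnergyEstimate
import HarnessLib

/-!
# Uniform-in-`δ` `Hᵐ` bounds for the regularised quasilinear flow (Grönwall and bootstrap)

Brick B-δ, §5, of the Kato existence programme for the symmetrizable branch of Rauch's Local
Existence Theorem (towards `Rauch1986_smallAmplitudeExpansionL2`). With the uniform energy
inequality `|d/dt ⟪S Y_α, Y_α⟫| ≤ C E` valid as long as `E ≤ 1`
(`exists_energy_deriv_bound`, `NoBVEstimatesMultiDEnergyEstimate.lean`) and the equivalence
`c₀ E ≤ E_S ≤ K₀ E` of the weighted energy `E_S = Σ_{|α| ≤ m} ⟪S Y_α, Y_α⟫` with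
`E = Σ_{|α| ≤ m} ‖Y_α‖²`, Grönwall's inequality and a continuity (bootstrap) argument give the
classical conclusion of the energy method [Majda1984, Ch. 2, Thm 2.1, (2.15)–(2.16)],
[TaylorPDEIII2011, Ch. 16, §1, (1.13)–(1.15)]: for data so small that
`(K₀/c₀) e^{γT} E(0) < 1`, the regularised solutions obey `E(t) ≤ (K₀/c₀) e^{γ|t|} E(0)` for ALL
`|t| ≤ T`, uniformly in the regularisation parameter `δ ∈ (0, 1]`:

* `bootstrap_forward`, `bootstrap_two_sided` — the abstract real-variable lemma (Grönwall on
  the maximal interval where `E ≤ 1`, which by real induction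
  `IsClosed.Icc_subset_of_forall_mem_nhdsWithin` is all of `[0, T]`);
* `exists_uniform_energy_bound` — **the uniform `Hᵐ` bound for the regularised flow**;
* `energy_zero_eq_wordEnergy` — `E(0) = Σ_{|α| ≤ m} ‖∂_α u₀‖₂²` is the word energy of the datum.

Everything is proved; no named fact and no `sorry` is introduced.

## References

* [Majda1984] A. Majda, *Compressible Fluid Flow and Systems of Conservation Laws in Several
  Space Variables* (1984), Ch. 2, §2.1, Thm 2.1, (2.15)–(2.16).
* [TaylorPDEIII2011] M. E. Taylor, *Partial Differential Equations III*, 2nd ed. (2011), Ch. 16,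
  §1, (1.13)–(1.15).
-/

noncomputable section

open MeasureTheory Set Function Filter Metric ContinuousLinearMap
open scoped ContDiff Topology ENNReal NNReal Convolution RealInnerProductSpace

namespace Literature.Barriers.AtomisticToContinuum

open Literature.Analysis.PDE Literature.Analysis.FunctionSpaces Literature.Analysis.ODE

variable {d k : ℕ}

/-! ### The abstract bootstrap lemma -/

/-- **Grönwall + bootstrap, forward in time.** Let `e, w : ℝ → ℝ` with `c₀ e ≤ w ≤ K₀ e`,
`e ≥ 0` continuous, `w` differentiable with `|w'| ≤ C_e e` WHENEVER `e ≤ 1`. If `0 ≤ T` and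
`(K₀/c₀) e^{(C_e/c₀)T} e(0) < 1` then `e(t) ≤ (K₀/c₀) e^{(C_e/c₀)t} e(0)` for all `t ∈ [0, T]`
(so in particular `e ≤ 1` there and the derivative bound was available all along).
[cite: Majda1984, Ch. 2 §2.1, (2.15)–(2.16)] -/
theorem bootstrap_forward {e w w' : ℝ → ℝ} {c₀ K₀ Ce T : ℝ} (hc₀ : 0 < c₀) (hK₀ : 0 ≤ K₀)
    (hCe : 0 ≤ Ce) (hT : 0 ≤ T) (h1 : ∀ t, c₀ * e t ≤ w t) (h2 : ∀ t, w t ≤ K₀ * e t)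
    (he : Continuous e) (he0 : ∀ t, 0 ≤ e t) (hw : ∀ t, HasDerivAt w (w' t) t)
    (h5 : ∀ t, e t ≤ 1 → |w' t| ≤ Ce * e t)
    (h6 : K₀ / c₀ * Real.exp (Ce / c₀ * T) * e 0 < 1) :
    ∀ t ∈ Icc 0 T, e t ≤ K₀ / c₀ * Real.exp (Ce / c₀ * t) * e 0 := by
  set γ : ℝ := Ce / c₀ with hγ
  have hγ0 : 0 ≤ γ := div_nonneg hCe hc₀.le
  have hw0 : ∀ t, 0 ≤ w t := fun t => le_trans (mul_nonneg hc₀.le (he0 t)) (h1 t)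
  have hew : ∀ t, e t ≤ w t / c₀ := fun t => by rw [le_div_iff₀ hc₀, mul_comm]; exact h1 t
  -- (G) Grönwall on an interval where `e ≤ 1`
  have hG : ∀ t₁ : ℝ, (∀ τ ∈ Icc 0 t₁, e τ ≤ 1) →
      ∀ τ ∈ Icc 0 t₁, e τ ≤ K₀ / c₀ * Real.exp (γ * τ) * e 0 := by
    intro t₁ hle τ hτ
    have hcont : ContinuousOn w (Icc 0 t₁) := fun x _ => (hw x).continuousAt.continuousWithinAt
    have hder : ∀ x ∈ Ico 0 t₁, HasDerivWithinAt w (w' x) (Ici x) x :=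
      fun x _ => (hw x).hasDerivWithinAt
    have hbound : ∀ x ∈ Ico 0 t₁, ‖w' x‖ ≤ γ * ‖w x‖ + 0 := by
      intro x hx
      rw [add_zero, Real.norm_eq_abs, Real.norm_eq_abs, abs_of_nonneg (hw0 x)]
      calc |w' x| ≤ Ce * e x := h5 x (hle x (Ico_subset_Icc_self hx))
        _ ≤ Ce * (w x / c₀) := mul_le_mul_of_nonneg_left (hew x) hCe
        _ = γ * w x := by rw [hγ]; ring
    have hg := norm_le_gronwallBound_of_norm_deriv_right_le hcont hder le_rfl hbound τ hτ
    rw [gronwallBound_ε0, sub_zero, Real.norm_eq_abs, Real.norm_eq_abs, abs_of_nonneg (hw0 τ),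
      abs_of_nonneg (hw0 0)] at hg
    calc e τ ≤ w τ / c₀ := hew τ
      _ ≤ w 0 * Real.exp (γ * τ) / c₀ := div_le_div_of_nonneg_right hg hc₀.le
      _ ≤ K₀ * e 0 * Real.exp (γ * τ) / c₀ :=
          div_le_div_of_nonneg_right (mul_le_mul_of_nonneg_right (h2 0) (Real.exp_nonneg _)) hc₀.le
      _ = K₀ / c₀ * Real.exp (γ * τ) * e 0 := by ring
  -- the bound is below `1` on `[0, T]`
  have hB1 : ∀ t ∈ Icc 0 T, K₀ / c₀ * Real.exp (γ * t) * e 0 < 1 := by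
    intro t ht
    refine lt_of_le_of_lt ?_ h6
    have : Real.exp (γ * t) ≤ Real.exp (Ce / c₀ * T) :=
      Real.exp_le_exp.2 (by rw [hγ]; exact mul_le_mul_of_nonneg_left ht.2 hγ0)
    exact mul_le_mul_of_nonneg_right (mul_le_mul_of_nonneg_left this (div_nonneg hK₀ hc₀.le)) (he0 0)
  -- (S) the invariant set `s = {t | e ≤ 1 on [0, max t 0]}`, in a manifestly closed form
  set s : Set ℝ := {t | ∀ τ : ℝ, 0 ≤ τ → e (min τ (max t 0)) ≤ 1} with hs
  have hs_closed : IsClosed s := by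
    have : s = ⋂ τ : ℝ, ⋂ (_ : 0 ≤ τ), {t | e (min τ (max t 0)) ≤ 1} := by
      ext t; simp [hs]
    rw [this]
    refine isClosed_iInter fun τ => isClosed_iInter fun _ => ?_
    exact isClosed_le (he.comp (continuous_const.min (continuous_id.max continuous_const)))
      continuous_const
  have hs_iff : ∀ t, 0 ≤ t → (t ∈ s ↔ ∀ τ ∈ Icc 0 t, e τ ≤ 1) := by
    intro t ht
    constructor
    · intro h τ hτ
      have := h τ hτ.1
      rwa [max_eq_left ht, min_eq_left hτ.2] at this
    · intro h τ hτ
      refine h _ ⟨le_min hτ (le_max_right _ _), ?_⟩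
      rw [max_eq_left ht]
      exact min_le_right _ _
  have h0s : (0 : ℝ) ∈ s := by
    rw [hs_iff 0 le_rfl]
    intro τ hτ
    have hτ0 : τ = 0 := le_antisymm hτ.2 hτ.1
    subst hτ0
    have hb : e 0 ≤ K₀ / c₀ * e 0 := by
      calc e 0 ≤ w 0 / c₀ := hew 0
        _ ≤ K₀ * e 0 / c₀ := div_le_div_of_nonneg_right (h2 0) hc₀.le
        _ = K₀ / c₀ * e 0 := by ring
    have := hB1 0 ⟨le_rfl, hT⟩
    rw [mul_zero, Real.exp_zero, mul_one] at this
    linarith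
  -- the induction step: `s` is open to the right inside `[0, T)`
  have hstep : ∀ t ∈ s ∩ Ico 0 T, s ∈ 𝓝[>] t := by
    rintro t ⟨hts, ht⟩
    have hle1 : ∀ τ ∈ Icc 0 t, e τ ≤ 1 := (hs_iff t ht.1).1 hts
    have het : e t < 1 := lt_of_le_of_lt (hG t hle1 t ⟨ht.1, le_rfl⟩) (hB1 t ⟨ht.1, ht.2.le⟩)
    -- continuity: `e < 1` on a neighbourhood of `t`
    have hnhds : ∀ᶠ τ in 𝓝 t, e τ < 1 := he.continuousAt.eventually (Iio_mem_nhds het)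
    obtain ⟨η, hη, hηb⟩ := Metric.eventually_nhds_iff.1 hnhds
    have hsub : Ioo t (t + η) ⊆ s := by
      intro t' ht'
      rw [hs, mem_setOf_eq]
      intro τ hτ
      have ht'0 : 0 ≤ t' := ht.1.trans ht'.1.le
      rw [max_eq_left ht'0]
      rcases le_or_gt (min τ t') t with hτt | hτt
      · exact hle1 _ ⟨le_min hτ ht'0, hτt⟩
      · refine le_of_lt (hηb ?_)
        rw [dist_eq_norm, Real.norm_eq_abs, abs_lt]
        constructor <;> [linarith; linarith [min_le_right τ t', ht'.2]]
    exact mem_of_superset (Ioo_mem_nhdsGT (by linarith)) hsub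
  have hIcc : Icc 0 T ⊆ s :=
    (hs_closed.inter isClosed_Icc).Icc_subset_of_forall_mem_nhdsWithin h0s hstep
  -- conclusion
  intro t ht
  have hts := hIcc ht
  exact hG t ((hs_iff t ht.1).1 hts) t ⟨ht.1, le_rfl⟩

/-- **Grönwall + bootstrap on `[-T, T]`** (the hypotheses of `bootstrap_forward` are symmetric
under time reversal `t ↦ -t`, `w' ↦ -w'`). [cite: Majda1984, Ch. 2 §2.1, (2.15)–(2.16)] -/
theorem bootstrap_two_sided {e w w' : ℝ → ℝ} {c₀ K₀ Ce T : ℝ} (hc₀ : 0 < c₀) (hK₀ : 0 ≤ K₀)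
    (hCe : 0 ≤ Ce) (hT : 0 ≤ T) (h1 : ∀ t, c₀ * e t ≤ w t) (h2 : ∀ t, w t ≤ K₀ * e t)
    (he : Continuous e) (he0 : ∀ t, 0 ≤ e t) (hw : ∀ t, HasDerivAt w (w' t) t)
    (h5 : ∀ t, e t ≤ 1 → |w' t| ≤ Ce * e t)
    (h6 : K₀ / c₀ * Real.exp (Ce / c₀ * T) * e 0 < 1) :
    ∀ t ∈ Icc (-T) T, e t ≤ K₀ / c₀ * Real.exp (Ce / c₀ * |t|) * e 0 := by
  intro t ht
  rcases le_or_gt 0 t with ht0 | ht0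
  · rw [abs_of_nonneg ht0]
    exact bootstrap_forward hc₀ hK₀ hCe hT h1 h2 he he0 hw h5 h6 t ⟨ht0, ht.2⟩
  · -- time reversal
    have hrev := bootstrap_forward (e := fun τ => e (-τ)) (w := fun τ => w (-τ))
      (w' := fun τ => -w' (-τ)) hc₀ hK₀ hCe hT (fun τ => h1 _) (fun τ => h2 _)
      (he.comp continuous_neg) (fun τ => he0 _)
      (fun τ => by
        have h' : HasDerivAt (fun σ => w (-σ)) (w' (-τ) * -1) τ := (hw (-τ)).comp τ (hasDerivAt_neg τ)
        simpa using h')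
      (fun τ hτ => by rw [abs_neg]; exact h5 _ hτ) (by simpa using h6) (-t)
      ⟨by linarith, by linarith [ht.1]⟩
    rw [abs_of_neg ht0]
    simpa using hrev

/-! ### The uniform `Hᵐ` bound for the regularised quasilinear flow -/

variable {M L : ℝ} {a : Fin d → EuclideanSpace ℝ (Fin k) → (EuclideanSpace ℝ (Fin k) →L[ℝ] EuclideanSpace ℝ (Fin k))}
  {b : EuclideanSpace ℝ (Fin k) → EuclideanSpace ℝ (Fin k)}
  {s : EuclideanSpace ℝ (Fin k) → (EuclideanSpace ℝ (Fin k) →L[ℝ] EuclideanSpace ℝ (Fin k))}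
  {u₀ : EuclideanSpace ℝ (Fin d) → EuclideanSpace ℝ (Fin k)}

/-- **The energy at time `0` is the word energy of the datum**:
`Σ_{|α| ≤ m} ‖Y_α(0)‖² = Σ_{|α| ≤ m} ‖∂_α u₀‖₂² = ℰ_m(u₀)`. [folklore] -/
theorem energy_zero_eq_wordEnergy (h : IsTameCoeff M L a b) {δ : ℝ} (hδ : 0 < δ)
    (hu₀ : ContDiff ℝ ∞ u₀) (hu₀c : HasCompactSupport u₀)
    (U : ℝ → Lp (EuclideanSpace ℝ (Fin k)) 2 (volume : Measure (EuclideanSpace ℝ (Fin d))))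
    (m : ℕ) :
    ∑ α ∈ wordsLE (Fin d) m, ‖dcurve h hδ hu₀ hu₀c U α 0‖ ^ 2 = wordEnergy m u₀ := by
  refine Finset.sum_congr rfl fun α _ => ?_
  rw [dcurve_zero, Lp.norm_toLp, ← l2norm_def]

/-- Continuity of the energy `t ↦ Σ_{|α| ≤ m} ‖Y_α(t)‖²`. [folklore] -/
theorem continuous_energy (h : IsTameCoeff M L a b) {δ : ℝ} (hδ : 0 < δ)
    (hu₀ : ContDiff ℝ ∞ u₀) (hu₀c : HasCompactSupport u₀)
    {U : ℝ → Lp (EuclideanSpace ℝ (Fin k)) 2 (volume : Measure (EuclideanSpace ℝ (Fin d)))}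
    (hUc : Continuous U) (m : ℕ) :
    Continuous fun t => ∑ α ∈ wordsLE (Fin d) m, ‖dcurve h hδ hu₀ hu₀c U α t‖ ^ 2 :=
  continuous_finsetSum _ fun α _ => ((continuous_dcurve h hδ hu₀ hu₀c hUc α).norm).pow 2

/-- **Uniform-in-`δ` `Hᵐ` bound for the regularised quasilinear flow.** For smooth
symmetrizable tame coefficients and an order `m ≥ 4(d+1)` there are `γ, K ≥ 0` such that for
every `δ ∈ (0, 1]`, every smooth compactly supported datum `u₀`, every solution `U : ℝ → L²` of
`U' = F_δ(U)` with `U(0) = u₀`, and every `T ≥ 0` with `K e^{γT} ℰ_m(u₀) < 1`: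
`Σ_{|α| ≤ m} ‖Y_α(t)‖² ≤ K e^{γ|t|} ℰ_m(u₀)` for all `|t| ≤ T` — the word derivatives of the
regularised solutions up to order `m` are bounded in `L²` uniformly in `δ`, in terms of the data
only. [cite: Majda1984, Ch. 2 §2.1, Thm 2.1, (2.15)–(2.16)];
[cite: TaylorPDEIII2011, Ch. 16 §1, (1.13)–(1.15)] -/
theorem exists_uniform_energy_bound (hS : IsSymmSmoothCoeff M L a b s) {m : ℕ}
    (hm : 4 * (d + 1) ≤ m) :
    ∃ γ K : ℝ, 0 ≤ γ ∧ 0 ≤ K ∧ ∀ {δ : ℝ} (hδ : 0 < δ), δ ≤ 1 →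
      ∀ (hu₀ : ContDiff ℝ ∞ u₀) (hu₀c : HasCompactSupport u₀)
        {U : ℝ → Lp (EuclideanSpace ℝ (Fin k)) 2 (volume : Measure (EuclideanSpace ℝ (Fin d)))},
        U 0 = dataL2 hu₀ hu₀c → (∀ t, HasDerivAt U (regField hS.toIsTameCoeff hδ (U t)) t) →
        ∀ T : ℝ, 0 ≤ T → K * Real.exp (γ * T) * wordEnergy m u₀ < 1 →
        ∀ t ∈ Icc (-T) T,
          ∑ α ∈ wordsLE (Fin d) m, ‖dcurve hS.toIsTameCoeff hδ hu₀ hu₀c U α t‖ ^ 2 ≤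
            K * Real.exp (γ * |t|) * wordEnergy m u₀ := by
  obtain ⟨c₀, hc₀, hcoer⟩ := hS.coercive
  obtain ⟨K₀, hK₀0, hK₀⟩ := hS.exists_norm_s_le
  obtain ⟨C, hC0, hC⟩ := exists_energy_deriv_bound hS hm (u₀ := u₀)
  set N : ℝ := ((wordsLE (Fin d) m).card : ℝ) with hN
  have hN0 : 0 ≤ N := Nat.cast_nonneg _
  refine ⟨N * C / c₀, K₀ / c₀, div_nonneg (mul_nonneg hN0 hC0) hc₀.le, div_nonneg hK₀0 hc₀.le, ?_⟩
  intro δ hδ hδ1 hu₀ hu₀c U hU0 hU T hT hsmall t ht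
  have hUc : Continuous U := continuous_iff_continuousAt.2 fun τ => (hU τ).continuousAt
  -- the two energies
  set e : ℝ → ℝ := fun τ => ∑ α ∈ wordsLE (Fin d) m, ‖dcurve hS.toIsTameCoeff hδ hu₀ hu₀c U α τ‖ ^ 2
    with he
  set w : ℝ → ℝ := fun τ => ∑ α ∈ wordsLE (Fin d) m,
    ⟪weightOp hS hδ (U τ) (dcurve hS.toIsTameCoeff hδ hu₀ hu₀c U α τ),
      dcurve hS.toIsTameCoeff hδ hu₀ hu₀c U α τ⟫ with hw
  set w' : ℝ → ℝ := fun τ => ∑ α ∈ wordsLE (Fin d) m,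
    (⟪weightOpDeriv hS hδ (U τ) (dcurve hS.toIsTameCoeff hδ hu₀ hu₀c U α τ),
        dcurve hS.toIsTameCoeff hδ hu₀ hu₀c U α τ⟫ +
      2 * ⟪weightOp hS hδ (U τ) (derivedField hS.toIsTameCoeff hδ α (U τ)),
        dcurve hS.toIsTameCoeff hδ hu₀ hu₀c U α τ⟫) with hw'
  have h1 : ∀ τ, c₀ * e τ ≤ w τ := fun τ => by
    simp only [he, hw, Finset.mul_sum]
    exact Finset.sum_le_sum fun α _ => inner_weightOp_self_ge hS hδ hcoer (U τ) _
  have h2 : ∀ τ, w τ ≤ K₀ * e τ := fun τ => by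
    simp only [he, hw, Finset.mul_sum]
    exact Finset.sum_le_sum fun α _ => inner_weightOp_self_le hS hδ hK₀ (U τ) _
  have hecont : Continuous e := continuous_energy hS.toIsTameCoeff hδ hu₀ hu₀c hUc m
  have he0 : ∀ τ, 0 ≤ e τ := fun τ => Finset.sum_nonneg fun _ _ => sq_nonneg _
  have hwd : ∀ τ, HasDerivAt w (w' τ) τ := fun τ => by
    simp only [hw, hw']
    exact HasDerivAt.fun_sum fun α _ => hasDerivAt_weightedTerm hS hδ hu₀ hu₀c hU α τ
  have h5 : ∀ τ, e τ ≤ 1 → |w' τ| ≤ N * C * e τ := by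
    intro τ hτ
    simp only [hw']
    refine (Finset.abs_sum_le_sum_abs _ _).trans ?_
    calc ∑ α ∈ wordsLE (Fin d) m,
          |⟪weightOpDeriv hS hδ (U τ) (dcurve hS.toIsTameCoeff hδ hu₀ hu₀c U α τ),
              dcurve hS.toIsTameCoeff hδ hu₀ hu₀c U α τ⟫ +
            2 * ⟪weightOp hS hδ (U τ) (derivedField hS.toIsTameCoeff hδ α (U τ)),
              dcurve hS.toIsTameCoeff hδ hu₀ hu₀c U α τ⟫|
        ≤ ∑ _α ∈ wordsLE (Fin d) m, C * e τ :=
          Finset.sum_le_sum fun α hα => hC hδ hδ1 hu₀ hu₀c hU0 hU τ hτ α (mem_wordsLE.1 hα)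
      _ = N * C * e τ := by rw [Finset.sum_const, nsmul_eq_mul, hN]; ring
  have h6 : K₀ / c₀ * Real.exp (N * C / c₀ * T) * e 0 < 1 := by
    have h0 : e 0 = wordEnergy m u₀ := energy_zero_eq_wordEnergy hS.toIsTameCoeff hδ hu₀ hu₀c U m
    rw [h0]
    exact hsmall
  have hres := bootstrap_two_sided hc₀ hK₀0 (mul_nonneg hN0 hC0) hT h1 h2 hecont he0 hwd h5 h6 t ht
  have h0 : e 0 = wordEnergy m u₀ := energy_zero_eq_wordEnergy hS.toIsTameCoeff hδ hu₀ hu₀c U m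
  rw [h0] at hres
  exact hres

end Literature.Barriers.AtomisticToContinuum

end
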